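import Literature.NumberTheory.Transcendental.AyoubPeriodSeriesKernel
import Mathlib.Algebra.MvPolynomial.Rename

/-!
# `StokesGeneration` (stmt-KontsevichZagierPeriods-3586), line `Sketch`, stub `stub_germToOan` — part 2:
evaluating absolutely summable series of `ℂ[[z₀, z₁, …]]` on the closed unit polydisc

Support file for the registered stub `stub_germToOan` (dictionary, analytic half) of the crux
`StokesGeneration` (route UnfoldedStokes, line `Sketch` = card cube-type-a-generation), on top of
`Literature/NumberTheory/Transcendental/AyoubPeriodSeries.lean` (`AyoubRel.CSeries = ℂ[[z₀, z₁, …]]`,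
`AyoubRel.DependsOnlyOnLT`).

For a point `y : ℕ → ℂ` of the closed unit polydisc (`‖yᵢ‖ ≤ 1`) and a series `F = Σ_b c_b z^b`
with `Σ_b ‖c_b‖ < ∞`, the value `F(y) = Σ_b c_b y^b` (written out as the `tsum`
`∑' b, coeff b F * b.prod (fun i e => y i ^ e)`; no definition is introduced) is an absolutely
convergent sum, and `F ↦ F(y)` is a ring homomorphism on such series: it is additive over finite
sums (`tsum_coeff_sum_mul_prod_pow`), multiplicative (`tsum_coeff_mul_mul_prod_pow`, Cauchy product
over `ℕ →₀ ℕ`), hence compatible with powers, and on polynomials it is polynomial evaluation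
(`tsum_coeff_coe_mul_prod_pow`). Consequently a polynomial combination `Σᵢ qᵢ Fⁱ` (`qᵢ ∈ ℂ[z]`)
evaluates to `Σᵢ qᵢ(y) F(y)ⁱ` (`tsum_coeff_polyComb_mul_prod_pow`). The last section records that
"depends only on `z₀, …, z_{m-1}`" is stable under these operations.

This is the evaluation half of the dictionary between real germs on the cube and Ayoub's series
`𝒪_{ℚ̄-alg}(𝔻̄^∞)` (J. Ayoub, EMS Newsl. 91 (2014) §2.2, Rem. 13; Ann. of Math. 181 (2015) §1.1).
-/

noncomputable section

-- `Summit.KontsevichZagierPeriods.KontsevichZagierPeriods.…` is the tree's mandated layout (single-conjunct summit).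
set_option linter.dupNamespace false

namespace Summit.KontsevichZagierPeriods.KontsevichZagierPeriods.StokesGenerationLine

open Finsupp MvPowerSeries
open Literature.NumberTheory.Transcendental
open Literature.NumberTheory.Transcendental.AyoubRel

/-! ## Monomials at a point of the closed unit polydisc -/

section Eval

variable {y : ℕ → ℂ}

/-- `y^{a+b} = y^a y^b`. [folklore] -/
theorem prod_pow_add (y : ℕ → ℂ) (a b : ℕ →₀ ℕ) :
    (a + b).prod (fun i e => y i ^ e) = a.prod (fun i e => y i ^ e) * b.prod (fun i e => y i ^ e) :=
  Finsupp.prod_add_index' (fun _ => pow_zero _) (fun _ _ _ => pow_add _ _ _)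

/-- `‖y^b‖ ≤ 1` on the closed unit polydisc. [folklore] -/
theorem norm_prod_pow_le_one (hy : ∀ i, ‖y i‖ ≤ 1) (b : ℕ →₀ ℕ) :
    ‖b.prod (fun i e => y i ^ e)‖ ≤ 1 := by
  rw [Finsupp.prod, norm_prod]
  refine Finset.prod_le_one (fun i _ => norm_nonneg _) fun i _ => ?_
  rw [norm_pow]
  exact pow_le_one₀ (norm_nonneg _) (hy i)

/-- The family `c_b y^b` is summable when `Σ ‖c_b‖ < ∞` and `‖yᵢ‖ ≤ 1`. [folklore] -/
theorem summable_coeff_mul_prod_pow (hy : ∀ i, ‖y i‖ ≤ 1) {F : CSeries}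
    (hF : Summable fun b : ℕ →₀ ℕ => ‖coeff b F‖) :
    Summable fun b : ℕ →₀ ℕ => coeff b F * b.prod (fun i e => y i ^ e) :=
  Summable.of_norm_bounded hF fun b => by
    rw [norm_mul]
    exact mul_le_of_le_one_right (norm_nonneg _) (norm_prod_pow_le_one hy b)

/-- Norm bound for the family `c_b y^b`. [folklore] -/
theorem summable_norm_coeff_mul_prod_pow (hy : ∀ i, ‖y i‖ ≤ 1) {F : CSeries}
    (hF : Summable fun b : ℕ →₀ ℕ => ‖coeff b F‖) :
    Summable fun b : ℕ →₀ ℕ => ‖coeff b F * b.prod (fun i e => y i ^ e)‖ :=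
  hF.of_nonneg_of_le (fun _ => norm_nonneg _) fun b => by
    rw [norm_mul]
    exact mul_le_of_le_one_right (norm_nonneg _) (norm_prod_pow_le_one hy b)

/-! ## Absolute summability of coefficients is stable under the ring operations -/

/-- Products: `Σ_c ‖(FG)_c‖ ≤ (Σ_a ‖F_a‖)(Σ_b ‖G_b‖)` (Cauchy product over `ℕ →₀ ℕ`). [folklore] -/
theorem summable_norm_coeff_mul {F G : CSeries} (hF : Summable fun b : ℕ →₀ ℕ => ‖coeff b F‖)
    (hG : Summable fun b : ℕ →₀ ℕ => ‖coeff b G‖) :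
    Summable fun b : ℕ →₀ ℕ => ‖coeff b (F * G)‖ := by
  set f : (ℕ →₀ ℕ) → ℝ := fun b => ‖coeff b F‖ with hf
  set g : (ℕ →₀ ℕ) → ℝ := fun b => ‖coeff b G‖ with hg
  have hprod : Summable fun x : (ℕ →₀ ℕ) × (ℕ →₀ ℕ) => f x.1 * g x.2 :=
    hF.mul_of_nonneg hG (fun _ => norm_nonneg _) (fun _ => norm_nonneg _)
  have hanti := summable_sum_mul_antidiagonal_of_summable_mul hprod
  refine Summable.of_nonneg_of_le (fun _ => norm_nonneg _) (fun a => ?_) hanti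
  calc ‖coeff a (F * G)‖
      = ‖∑ p ∈ Finset.HasAntidiagonal.antidiagonal a, coeff p.1 F * coeff p.2 G‖ := by
        rw [coeff_mul]
    _ ≤ ∑ p ∈ Finset.HasAntidiagonal.antidiagonal a, ‖coeff p.1 F * coeff p.2 G‖ :=
        norm_sum_le _ _
    _ ≤ ∑ p ∈ Finset.HasAntidiagonal.antidiagonal a, f p.1 * g p.2 :=
        Finset.sum_le_sum fun p _ => norm_mul_le _ _

/-- Finite sums. [folklore] -/
theorem summable_norm_coeff_sum {ι : Type*} (s : Finset ι) (H : ι → CSeries)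
    (hH : ∀ i ∈ s, Summable fun b : ℕ →₀ ℕ => ‖coeff b (H i)‖) :
    Summable fun b : ℕ →₀ ℕ => ‖coeff b (∑ i ∈ s, H i)‖ := by
  refine Summable.of_nonneg_of_le (fun _ => norm_nonneg _) (fun b => ?_)
    (summable_sum fun i hi => hH i hi)
  rw [map_sum]
  exact norm_sum_le _ _

/-- Polynomials (finite support). [folklore] -/
theorem summable_norm_coeff_coe (q : MvPolynomial ℕ ℂ) :
    Summable fun b : ℕ →₀ ℕ => ‖coeff b (q : CSeries)‖ := by
  refine summable_of_ne_finset_zero (s := q.support) fun b hb => ?_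
  rw [MvPolynomial.coeff_coe, MvPolynomial.notMem_support_iff.mp hb, norm_zero]

/-- Powers. [folklore] -/
theorem summable_norm_coeff_pow {F : CSeries} (hF : Summable fun b : ℕ →₀ ℕ => ‖coeff b F‖) :
    ∀ n : ℕ, Summable fun b : ℕ →₀ ℕ => ‖coeff b (F ^ n)‖
  | 0 => by
    rw [pow_zero, ← MvPolynomial.coe_one]
    exact summable_norm_coeff_coe 1
  | n + 1 => by
    rw [pow_succ]
    exact summable_norm_coeff_mul (summable_norm_coeff_pow hF n) hF

/-! ## Evaluation is a ring homomorphism -/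

/-- **Multiplicativity**: `(FG)(y) = F(y) G(y)` for absolutely summable `F`, `G` and `‖yᵢ‖ ≤ 1`
(Cauchy product over `ℕ →₀ ℕ`, `y^{a+b} = y^a y^b`). [folklore] -/
theorem tsum_coeff_mul_mul_prod_pow (hy : ∀ i, ‖y i‖ ≤ 1) {F G : CSeries}
    (hF : Summable fun b : ℕ →₀ ℕ => ‖coeff b F‖)
    (hG : Summable fun b : ℕ →₀ ℕ => ‖coeff b G‖) :
    ∑' b : ℕ →₀ ℕ, coeff b (F * G) * b.prod (fun i e => y i ^ e) =
      (∑' b : ℕ →₀ ℕ, coeff b F * b.prod (fun i e => y i ^ e)) *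
        ∑' b : ℕ →₀ ℕ, coeff b G * b.prod (fun i e => y i ^ e) := by
  set f : (ℕ →₀ ℕ) → ℂ := fun b => coeff b F * b.prod (fun i e => y i ^ e) with hf
  set g : (ℕ →₀ ℕ) → ℂ := fun b => coeff b G * b.prod (fun i e => y i ^ e) with hg
  have hfn : Summable fun b => ‖f b‖ := summable_norm_coeff_mul_prod_pow hy hF
  have hgn : Summable fun b => ‖g b‖ := summable_norm_coeff_mul_prod_pow hy hG
  have hprod : Summable fun x : (ℕ →₀ ℕ) × (ℕ →₀ ℕ) => f x.1 * g x.2 :=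
    summable_mul_of_summable_norm hfn hgn
  rw [hfn.of_norm.tsum_mul_tsum_eq_tsum_sum_antidiagonal hgn.of_norm hprod]
  refine tsum_congr fun c => ?_
  rw [coeff_mul, Finset.sum_mul]
  refine Finset.sum_congr rfl fun p hp => ?_
  rw [Finset.HasAntidiagonal.mem_antidiagonal] at hp
  rw [hf, hg]
  simp only
  rw [← hp, prod_pow_add]
  ring

/-- **Additivity over finite sums**: `(Σᵢ Hᵢ)(y) = Σᵢ Hᵢ(y)`. [folklore] -/
theorem tsum_coeff_sum_mul_prod_pow (hy : ∀ i, ‖y i‖ ≤ 1) {ι : Type*} (s : Finset ι)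
    (H : ι → CSeries) (hH : ∀ i ∈ s, Summable fun b : ℕ →₀ ℕ => ‖coeff b (H i)‖) :
    ∑' b : ℕ →₀ ℕ, coeff b (∑ i ∈ s, H i) * b.prod (fun i e => y i ^ e) =
      ∑ i ∈ s, ∑' b : ℕ →₀ ℕ, coeff b (H i) * b.prod (fun i e => y i ^ e) := by
  rw [← Summable.tsum_finsetSum (fun i hi => summable_coeff_mul_prod_pow hy (hH i hi))]
  refine tsum_congr fun b => ?_
  rw [map_sum, Finset.sum_mul]

/-- **Polynomials evaluate as polynomials**: `q(y) = MvPolynomial.eval y q`. [folklore] -/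
theorem tsum_coeff_coe_mul_prod_pow (y : ℕ → ℂ) (q : MvPolynomial ℕ ℂ) :
    ∑' b : ℕ →₀ ℕ, coeff b (q : CSeries) * b.prod (fun i e => y i ^ e) =
      MvPolynomial.eval y q := by
  rw [MvPolynomial.eval_eq, tsum_eq_sum (s := q.support)]
  · refine Finset.sum_congr rfl fun b _ => ?_
    rw [MvPolynomial.coeff_coe, Finsupp.prod]
  · intro b hb
    rw [MvPolynomial.coeff_coe, MvPolynomial.notMem_support_iff.mp hb, zero_mul]

/-- **Powers**: `(Fⁿ)(y) = F(y)ⁿ`. [folklore] -/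
theorem tsum_coeff_pow_mul_prod_pow (hy : ∀ i, ‖y i‖ ≤ 1) {F : CSeries}
    (hF : Summable fun b : ℕ →₀ ℕ => ‖coeff b F‖) :
    ∀ n : ℕ, ∑' b : ℕ →₀ ℕ, coeff b (F ^ n) * b.prod (fun i e => y i ^ e) =
      (∑' b : ℕ →₀ ℕ, coeff b F * b.prod (fun i e => y i ^ e)) ^ n
  | 0 => by
    rw [pow_zero, pow_zero, ← MvPolynomial.coe_one, tsum_coeff_coe_mul_prod_pow, map_one]
  | n + 1 => by
    rw [pow_succ, pow_succ, tsum_coeff_mul_mul_prod_pow hy (summable_norm_coeff_pow hF n) hF,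
      tsum_coeff_pow_mul_prod_pow hy hF n]

/-- A polynomial combination `Σᵢ qᵢ Fⁱ` (`qᵢ ∈ ℂ[z]`) of an absolutely summable `F` is absolutely
summable. [folklore] -/
theorem summable_norm_coeff_polyComb (s : Finset ℕ) (q : ℕ → MvPolynomial ℕ ℂ) {F : CSeries}
    (hF : Summable fun b : ℕ →₀ ℕ => ‖coeff b F‖) :
    Summable fun b : ℕ →₀ ℕ => ‖coeff b (∑ i ∈ s, ((q i : MvPolynomial ℕ ℂ) : CSeries) * F ^ i)‖ :=
  summable_norm_coeff_sum s _ fun i _ =>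
    summable_norm_coeff_mul (summable_norm_coeff_coe (q i)) (summable_norm_coeff_pow hF i)

/-- **Evaluation of a polynomial combination**: `(Σᵢ qᵢ Fⁱ)(y) = Σᵢ qᵢ(y) F(y)ⁱ`. [folklore] -/
theorem tsum_coeff_polyComb_mul_prod_pow (hy : ∀ i, ‖y i‖ ≤ 1) (s : Finset ℕ)
    (q : ℕ → MvPolynomial ℕ ℂ) {F : CSeries} (hF : Summable fun b : ℕ →₀ ℕ => ‖coeff b F‖) :
    ∑' b : ℕ →₀ ℕ, coeff b (∑ i ∈ s, ((q i : MvPolynomial ℕ ℂ) : CSeries) * F ^ i) *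
        b.prod (fun i e => y i ^ e) =
      ∑ i ∈ s, MvPolynomial.eval y (q i) *
        (∑' b : ℕ →₀ ℕ, coeff b F * b.prod (fun i e => y i ^ e)) ^ i := by
  rw [tsum_coeff_sum_mul_prod_pow hy s _ (fun i _ =>
    summable_norm_coeff_mul (summable_norm_coeff_coe (q i)) (summable_norm_coeff_pow hF i))]
  refine Finset.sum_congr rfl fun i _ => ?_
  rw [tsum_coeff_mul_mul_prod_pow hy (summable_norm_coeff_coe (q i)) (summable_norm_coeff_pow hF i),
    tsum_coeff_coe_mul_prod_pow, tsum_coeff_pow_mul_prod_pow hy hF]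

end Eval

/-! ## "Depends only on `z₀, …, z_{m-1}`" is stable under the ring operations -/

section Depends

/-- Finite sums. [folklore] -/
theorem dependsOnlyOnLT_sum {ι : Type*} (s : Finset ι) (H : ι → CSeries) {m : ℕ}
    (hH : ∀ i ∈ s, DependsOnlyOnLT (H i) m) : DependsOnlyOnLT (∑ i ∈ s, H i) m := fun a ha => by
  rw [map_sum]
  exact Finset.sum_eq_zero fun i hi => hH i hi a ha

/-- `1` depends on no variable. [folklore] -/
theorem dependsOnlyOnLT_one (m : ℕ) : DependsOnlyOnLT (1 : CSeries) m := fun a ⟨i, _, hi⟩ => by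
  rw [MvPowerSeries.coeff_one, if_neg]
  rintro rfl
  exact hi rfl

/-- Products (same bound). [folklore] -/
theorem dependsOnlyOnLT_mul {F G : CSeries} {m : ℕ} (hF : DependsOnlyOnLT F m)
    (hG : DependsOnlyOnLT G m) : DependsOnlyOnLT (F * G) m := by
  rintro a ⟨i, hi, hai⟩
  rw [coeff_mul]
  refine Finset.sum_eq_zero fun p hp => ?_
  rw [Finset.HasAntidiagonal.mem_antidiagonal] at hp
  have hpi : p.1 i + p.2 i = a i := by rw [← hp, Finsupp.add_apply]
  by_cases h1 : p.1 i = 0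
  · rw [hG p.2 ⟨i, hi, by omega⟩, mul_zero]
  · rw [hF p.1 ⟨i, hi, h1⟩, zero_mul]

/-- Powers. [folklore] -/
theorem dependsOnlyOnLT_pow {F : CSeries} {m : ℕ} (hF : DependsOnlyOnLT F m) :
    ∀ n : ℕ, DependsOnlyOnLT (F ^ n) m
  | 0 => by
    rw [pow_zero]
    exact dependsOnlyOnLT_one m
  | n + 1 => by
    rw [pow_succ]
    exact dependsOnlyOnLT_mul (dependsOnlyOnLT_pow hF n) hF

/-- A polynomial in the variables `z₀, …, z_{N-1}` (pushed into `ℂ[z₀, z₁, …]` along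
`Fin.val : Fin N → ℕ`) depends only on those variables. [folklore] -/
theorem dependsOnlyOnLT_coe_rename {N : ℕ} (r : MvPolynomial (Fin N) ℂ) :
    DependsOnlyOnLT ((MvPolynomial.rename Fin.val r : MvPolynomial ℕ ℂ) : CSeries) N := by
  rintro a ⟨i, hi, hai⟩
  rw [MvPolynomial.coeff_coe]
  refine MvPolynomial.coeff_rename_eq_zero _ _ _ fun u hu => ?_
  exfalso
  have h0 : (Finsupp.mapDomain Fin.val u) i = 0 :=
    Finsupp.mapDomain_notin_range _ _ (by
      rintro ⟨j, rfl⟩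
      exact absurd j.2 (not_lt.2 hi))
  rw [hu] at h0
  exact hai h0

/-- A polynomial combination `Σᵢ qᵢ Fⁱ` with `qᵢ ∈ ℂ[z₀, …, z_{N-1}]` and `F` depending only on
`z₀, …, z_{N-1}` depends only on those variables. [folklore] -/
theorem dependsOnlyOnLT_polyComb {N : ℕ} (s : Finset ℕ) (r : ℕ → MvPolynomial (Fin N) ℂ)
    {F : CSeries} (hF : DependsOnlyOnLT F N) :
    DependsOnlyOnLT
      (∑ i ∈ s, ((MvPolynomial.rename Fin.val (r i) : MvPolynomial ℕ ℂ) : CSeries) * F ^ i) N :=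
  dependsOnlyOnLT_sum s _ fun i _ =>
    dependsOnlyOnLT_mul (dependsOnlyOnLT_coe_rename (r i)) (dependsOnlyOnLT_pow hF i)

end Depends

/-! ## Registered form -/

/-- **Registered auxiliary stub** `stub_germToOanAuxEval` (sub-goal of `stub_germToOan`, crux
stmt-KontsevichZagierPeriods-3586): evaluation at a point of the closed unit polydisc of a polynomial
combination `Σᵢ qᵢ Fⁱ` of an absolutely summable series is `Σᵢ qᵢ(y) F(y)ⁱ`, in the form registered on
the ledger (= `tsum_coeff_polyComb_mul_prod_pow`). [folklore] -/
theorem stub_germToOanAuxEval :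
    ∀ (y : ℕ → ℂ), (∀ i, ‖y i‖ ≤ 1) → ∀ (s : Finset ℕ) (q : ℕ → MvPolynomial ℕ ℂ)
      (F : MvPowerSeries ℕ ℂ), Summable (fun b : ℕ →₀ ℕ => ‖MvPowerSeries.coeff b F‖) →
      ∑' b : ℕ →₀ ℕ, MvPowerSeries.coeff b
          (∑ i ∈ s, ((q i : MvPolynomial ℕ ℂ) : MvPowerSeries ℕ ℂ) * F ^ i) *
        b.prod (fun i e => y i ^ e) =
      ∑ i ∈ s, MvPolynomial.eval y (q i) *
        (∑' b : ℕ →₀ ℕ, MvPowerSeries.coeff b F * b.prod (fun i e => y i ^ e)) ^ i :=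
  fun _ hy s q _ hF => tsum_coeff_polyComb_mul_prod_pow hy s q hF

end Summit.KontsevichZagierPeriods.KontsevichZagierPeriods.StokesGenerationLine
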